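import Mathlib
import HarnessLib
import Literature.MathematicalPhysics.QuantumLattice.GaugeGroups
import Literature.MathematicalPhysics.QuantumFieldTheory.ConstructiveQFTWave0
import Literature.MathematicalPhysics.QuantumFieldTheory.LatticeGaugeProofs
import Summits.Ventures.LatticeQCDFlow.Scaling.FluxTunnellingU1ExplicitLaw

/-!
# LatticeQCDFlow / Scaling — the explicit 2-d `U(1)` single-link tunnelling law at EVERY volume `L ≥ 2` (odd `L` included)

HONEST FRAMING: exact (Metropolis-corrected) sampling algorithms for lattice gauge theory; figures of merit are
autocorrelation/cost numbers at stated couplings and volumes; no continuum-physics claim.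

Venture `LatticeQCDFlow` (cell pub-lqcd), topic `Scaling`, FANOUT row 30 (lean-1) — OUR WORK, file 6 of the explicit
`U(1)` tunnelling programme.  Files 4–5 need `L` EVEN (the Cauchy–Schwarz ratio chain of `HaarConvolutionRatio` reaches
the partition function only when `L² − 1` is odd).  For odd `L` one more convolution step separates them; it is
absorbed here at the cost of a factor `c(β) = e^{−3/2}/(π·max(1,β))` by a pointwise bound (positivity of `K_w`, not
proved, would cost nothing): `haarConv_u1_weight_ge` (`(K_w w)(u) ≥ c(β)·w(u)`: restrict to the arc
`|φ| ≤ 1/max(1,β)`, `cos` is `1`-Lipschitz, the Haar mass is `≥ 1/(π max(1,β))`), `mul_iterate_le_iterate_succ`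
(`c(β)·a_{2l} ≤ a_{2l+1}`); **`u1_mul_pow_mul_lintegral_le`** — PATCH COMPARISON at every `L ≥ 2`:
`c(β)·z₁(β)^{n+#P}·∫ f(U_·) dμ_{β,L} ≤ ∫ f ∏_{x∈P} w_β(g_x) dHaar^{⊗Λ}` (`#P ≤ 2n`, `2n + 2 ≤ L²`);
**`u1_tunnelling_single_link_all`** — for EVERY `L ≥ 2`, `β ≥ 0`: `c(β)·z₁(β)³·(μ_{β,L} ⊗ κ){Q ≠ Q'} ≤ 2·e^{−2β}`
for every `μ_{β,L}`-invariant Markov kernel changing one link; in numbers (`β ≥ 1`)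
`(μ_{β,L} ⊗ κ){Q ≠ Q'} ≤ 2e³π⁴·β^{5/2}·e^{−2β}` (`…_explicit`).  Elementary; nothing is cited as a fact; no `def`.
-/

noncomputable section

namespace Summit.Ventures.LatticeQCDFlow.Theory2.Lattice.TwoDim

open MeasureTheory ProbabilityTheory Literature.MathematicalPhysics.QuantumFieldTheory
open Literature.MathematicalPhysics.QuantumLattice (u1Rep u1Rep_apply continuous_u1Rep)
open Summit.Ventures.LatticeQCDFlow.Theory2.HaarConv Summit.Ventures.LatticeQCDFlow.Theory2.Lattice.Flux
open scoped ENNReal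

variable {L : ℕ}

/-! ## §1. One convolution step costs at most `c(β) = e^{−3/2}/(π·max(1,β))` -/
/-- The weight after a small rotation: `w(u·e^{iφ}) ≥ e^{−β|φ|}·w(u)` (`cos` is `1`-Lipschitz). [folklore] -/
theorem u1_weight_mul_exp_ge (β : ℝ) (hβ : 0 ≤ β) (u : Circle) (φ : ℝ) :
    ENNReal.ofReal (Real.exp (-(β * |φ|))) *
        ENNReal.ofReal (Real.exp (-(β * (((1 : ℕ) : ℝ) - (u1Rep u).trace.re)))) ≤
      ENNReal.ofReal (Real.exp (-(β * (((1 : ℕ) : ℝ) - (u1Rep (u * Circle.exp φ)).trace.re)))) := by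
  rw [← ENNReal.ofReal_mul (Real.exp_pos _).le, ← Real.exp_add]
  refine ENNReal.ofReal_le_ofReal (Real.exp_le_exp.mpr ?_)
  obtain ⟨θ, rfl⟩ := Circle.exp_surjective u
  rw [← Circle.exp_add, trace_u1Rep_re, trace_u1Rep_re, U1.re_coe_exp, U1.re_coe_exp, Nat.cast_one]
  have h := Real.abs_cos_sub_cos_le θ (θ + φ)
  rw [show θ - (θ + φ) = -φ by ring, abs_neg] at h
  have h' := (abs_le.mp h).2
  nlinarith

/-- **`(K_w w)(u) ≥ c(β)·w(u)`** with `c(β) = e^{−3/2}/(π·max(1,β))`, `β ≥ 0`. [folklore] -/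
theorem haarConv_u1_weight_ge {β : ℝ} (hβ : 0 ≤ β) (u : Circle) :
    ENNReal.ofReal (Real.exp (-(3 / 2)) * (1 / Real.pi * (max 1 β)⁻¹)) *
        ENNReal.ofReal (Real.exp (-(β * (((1 : ℕ) : ℝ) - (u1Rep u).trace.re)))) ≤
      haarConv (fun g => ENNReal.ofReal (Real.exp (-(β * (((1 : ℕ) : ℝ) - (u1Rep g).trace.re)))))
        (fun g => ENNReal.ofReal (Real.exp (-(β * (((1 : ℕ) : ℝ) - (u1Rep g).trace.re))))) u := by
  set w : Circle → ℝ≥0∞ :=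
    fun g => ENNReal.ofReal (Real.exp (-(β * (((1 : ℕ) : ℝ) - (u1Rep g).trace.re)))) with hwdef
  have hm : 0 < max 1 β := lt_of_lt_of_le one_pos (le_max_left _ _)
  set ε : ℝ := (max 1 β)⁻¹ with hε
  have hε0 : 0 < ε := inv_pos.mpr hm; have hε1 : ε ≤ 1 := inv_le_one_of_one_le₀ (le_max_left _ _)
  have hβε : β * ε ≤ 1 := by
    rw [hε]; exact (mul_inv_le_iff₀ hm).mpr (by rw [one_mul]; exact le_max_right 1 β)
  -- on the arc: `w(u g) w(g) ≥ e^{-1} w(u) · e^{-1/2}`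
  have harc : ∀ g ∈ U1.arc ε, ENNReal.ofReal (Real.exp (-(3 / 2))) * w u ≤ w (u * g) * w g := by
    intro g hg
    obtain ⟨φ, hφ, rfl⟩ := U1.exists_angle_of_mem hε0.le (Set.mem_insert_of_mem _ (Set.mem_union_left _ hg))
    have h1 : ENNReal.ofReal (Real.exp (-1)) * w u ≤ w (u * Circle.exp φ) := by
      refine le_trans (mul_le_mul' (ENNReal.ofReal_le_ofReal (Real.exp_le_exp.mpr ?_)) le_rfl)
        (u1_weight_mul_exp_ge β hβ u φ)
      nlinarith [abs_nonneg φ, hφ, hβε, hβ]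
    have h2 : ENNReal.ofReal (Real.exp (-(1 / 2))) ≤ w (Circle.exp φ) := by
      refine ENNReal.ofReal_le_ofReal (Real.exp_le_exp.mpr ?_)
      rw [trace_u1Rep_re, U1.re_coe_exp, Nat.cast_one]
      have hcos := Real.one_sub_sq_div_two_le_cos (x := φ)
      have hφ2 : φ ^ 2 ≤ ε ^ 2 := by
        have := abs_le.mp hφ; nlinarith [sq_abs φ, abs_nonneg φ]
      have hε2 : β * ε ^ 2 ≤ 1 := by nlinarith
      nlinarith
    calc ENNReal.ofReal (Real.exp (-(3 / 2))) * w u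
        = (ENNReal.ofReal (Real.exp (-1)) * w u) * ENNReal.ofReal (Real.exp (-(1 / 2))) := by
          rw [show (-(3 / 2) : ℝ) = -1 + -(1 / 2) by norm_num, Real.exp_add,
            ENNReal.ofReal_mul (Real.exp_pos _).le]; ring
      _ ≤ w (u * Circle.exp φ) * w (Circle.exp φ) := mul_le_mul' h1 h2
  -- Haar mass of the arc
  have hmass : ENNReal.ofReal (1 / Real.pi * ε) ≤ haarProbability Circle (U1.arc ε) := by
    refine ENNReal.ofReal_le_of_le_toReal ?_
    have h := U1.haar_arc_ge hε0 hε1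
    rwa [Real.rpow_one] at h
  have hwm : Measurable w := measurable_oneWeight u1Rep continuous_u1Rep β
  unfold haarConv
  calc ENNReal.ofReal (Real.exp (-(3 / 2)) * (1 / Real.pi * (max 1 β)⁻¹)) * w u
      = (ENNReal.ofReal (Real.exp (-(3 / 2))) * w u) * ENNReal.ofReal (1 / Real.pi * ε) := by
        rw [ENNReal.ofReal_mul (Real.exp_pos _).le]; ring
    _ ≤ (ENNReal.ofReal (Real.exp (-(3 / 2))) * w u) * haarProbability Circle (U1.arc ε) := by gcongr
    _ = ∫⁻ g in U1.arc ε, ENNReal.ofReal (Real.exp (-(3 / 2))) * w u ∂(haarProbability Circle) := by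
        rw [setLIntegral_const]
    _ ≤ ∫⁻ g in U1.arc ε, w (u * g) * w g ∂(haarProbability Circle) :=
        setLIntegral_mono ((hwm.comp (measurable_const_mul u)).mul hwm) harc
    _ ≤ ∫⁻ g, w (u * g) * w g ∂(haarProbability Circle) := setLIntegral_le_lintegral _ _

/-- Hence one more convolution step costs at most `c(β)`: `c(β)·(K_w^{2l+1} w)(1) ≤ (K_w^{2l+2} w)(1)`. [folklore] -/
theorem mul_iterate_le_iterate_succ {β : ℝ} (hβ : 0 ≤ β) (k : ℕ) :
    ENNReal.ofReal (Real.exp (-(3 / 2)) * (1 / Real.pi * (max 1 β)⁻¹)) *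
        (haarConv fun g => ENNReal.ofReal (Real.exp (-(β * (((1 : ℕ) : ℝ) - (u1Rep g).trace.re)))))^[k + 1]
          (fun g => ENNReal.ofReal (Real.exp (-(β * (((1 : ℕ) : ℝ) - (u1Rep g).trace.re))))) 1 ≤
      (haarConv fun g => ENNReal.ofReal (Real.exp (-(β * (((1 : ℕ) : ℝ) - (u1Rep g).trace.re)))))^[k + 2]
        (fun g => ENNReal.ofReal (Real.exp (-(β * (((1 : ℕ) : ℝ) - (u1Rep g).trace.re))))) 1 := by
  set w : Circle → ℝ≥0∞ :=
    fun g => ENNReal.ofReal (Real.exp (-(β * (((1 : ℕ) : ℝ) - (u1Rep g).trace.re)))) with hwdef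
  have hw : Measurable w := measurable_oneWeight u1Rep continuous_u1Rep β
  have hws : ∀ g, w g⁻¹ = w g := u1_weight_symm β
  have hm' : Measurable fun v => (haarConv w)^[k] w v * w v := (measurable_iterate hw hw k).mul hw
  rw [show k + 2 = (k + 1) + 1 by ring, iterate_succ_apply_one, iterate_succ_apply_one,
    Function.iterate_succ_apply', lintegral_haarConv_mul hw hws (measurable_iterate hw hw k) hw]
  refine le_trans (lintegral_const_mul _ hm').symm.le (lintegral_mono fun g => ?_)
  rw [mul_comm (ENNReal.ofReal _), mul_assoc]
  refine mul_le_mul' le_rfl ?_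
  rw [mul_comm]
  exact haarConv_u1_weight_ge hβ g

/-! ## §2. The patch comparison at every volume -/
/-- **PATCH COMPARISON AT EVERY VOLUME** (`L ≥ 2`, `β ≥ 0`): for a patch `P` of sites, `n` with `#P ≤ 2n`,
`2n + 2 ≤ L²`, and `f ≥ 0` measurable depending only on the plaquettes of `P`,
`c(β)·z₁(β)^{n+#P}·∫ f(U_·) dμ_{β,L} ≤ ∫ f(g)·∏_{x∈P} w_β(g_x) dHaar^{⊗Λ}(g)`, `c(β) = e^{−3/2}/(π·max(1,β))`. [folklore] -/
theorem u1_mul_pow_mul_lintegral_le [NeZero L] (hL : 2 ≤ L) {β : ℝ} (hβ : 0 ≤ β)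
    (P : Finset (Site 2 L)) (n : ℕ) (hPn : P.card ≤ 2 * n) (hn : 2 * n + 2 ≤ L ^ 2)
    {f : (Site 2 L → Circle) → ℝ≥0∞} (hfm : Measurable f)
    (hf : ∀ g g' : Site 2 L → Circle, (∀ x ∈ P, g x = g' x) → f g = f g') :
    ENNReal.ofReal (Real.exp (-(3 / 2)) * (1 / Real.pi * (max 1 β)⁻¹)) * z1 u1Rep β ^ (n + P.card) *
        ∫⁻ U, f (fun x => plaquetteHolonomy U x 0 1) ∂(wilsonMeasure (d := 2) (L := L) u1Rep β) ≤
      ∫⁻ g, f g * ∏ x ∈ P, ENNReal.ofReal (Real.exp (-(β * (((1 : ℕ) : ℝ) - (u1Rep (g x)).trace.re))))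
        ∂(Measure.pi fun _ : Site 2 L => haarProbability Circle) := by
  classical
  set w : Circle → ℝ≥0∞ :=
    fun g => ENNReal.ofReal (Real.exp (-(β * (((1 : ℕ) : ℝ) - (u1Rep g).trace.re)))) with hwdef
  set c : ℝ≥0∞ := ENNReal.ofReal (Real.exp (-(3 / 2)) * (1 / Real.pi * (max 1 β)⁻¹)) with hc
  have hw : Measurable w := measurable_oneWeight u1Rep continuous_u1Rep β
  have hws : ∀ g, w g⁻¹ = w g := u1_weight_symm β
  have hw0 : ∀ g, w g ≠ 0 := u1_weight_ne_zero β; have hw1 : ∀ g, w g ≤ 1 := u1_weight_le_one hβ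
  have hc1 : c ≤ 1 := by
    refine ENNReal.ofReal_le_one.mpr ?_
    have h1 : Real.exp (-(3 / 2)) ≤ 1 := Real.exp_le_one_iff.mpr (by norm_num)
    have h2 : 1 / Real.pi * (max 1 β)⁻¹ ≤ 1 := by
      have hπ : 1 / Real.pi ≤ 1 := by
        rw [div_le_one Real.pi_pos]; linarith [Real.pi_gt_three]
      have hm : (max 1 β)⁻¹ ≤ 1 := inv_le_one_of_one_le₀ (le_max_left _ _)
      calc 1 / Real.pi * (max 1 β)⁻¹ ≤ 1 * 1 := by gcongr
        _ = 1 := one_mul _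
    calc Real.exp (-(3 / 2)) * (1 / Real.pi * (max 1 β)⁻¹) ≤ 1 * 1 :=
          mul_le_mul h1 h2 (by positivity) zero_le_one
      _ = 1 := one_mul _
  -- `L²` as a plain number with its parity bit
  obtain ⟨N, hN⟩ : ∃ N, L ^ 2 = N := ⟨_, rfl⟩
  have hcardU : (Finset.univ : Finset (Site 2 L)).card = N := by
    rw [Finset.card_univ, Fintype.card_fun, ZMod.card, Fintype.card_fin, hN]
  rw [hN] at hn
  set l := (N - 2) / 2 with hl
  set b := (N - 2) % 2 with hb
  have hlb : 2 * l + b = N - 2 := Nat.div_add_mod (N - 2) 2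
  have hb1 : b < 2 := Nat.mod_lt _ (by norm_num)
  -- a puncture off `P`
  have hcard : P.card < (Finset.univ : Finset (Site 2 L)).card := by rw [hcardU]; omega
  obtain ⟨x₀, -, hx₀⟩ := Finset.exists_mem_notMem_of_card_lt_card hcard
  obtain ⟨i, hi⟩ : ∃ i, l = i + n := ⟨l - n, by omega⟩
  set k := b + 2 * n - P.card with hk
  have hPsub : P ⊆ Finset.univ.erase x₀ := fun x hx =>
    Finset.mem_erase.mpr ⟨fun h => hx₀ (h ▸ hx), Finset.mem_univ _⟩
  have hRcard : ((Finset.univ.erase x₀) \ P).card = k + (2 * i + 1) := by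
    rw [Finset.card_sdiff_of_subset hPsub, Finset.card_erase_of_mem (Finset.mem_univ _), hcardU]
    omega
  -- the analytic inputs
  have hM : ∀ u, (haarConv w)^[((Finset.univ.erase x₀) \ P).card] w u ≤
      (haarConv w)^[2 * i + 1] w 1 * (∫⁻ g, w g ∂(haarProbability Circle)) ^ k := fun u => by
    rw [hRcard]; exact iterate_apply_le_pow_mul hw hws i k u
  have hchain := pow_mul_iterate_le hw hws hw0 hw1 i n
  have hZeq : partitionFunction (d := 2) (L := L) u1Rep β = (haarConv w)^[N - 1] w 1 := by
    unfold partitionFunction wilsonWeight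
    rw [withDensity_apply _ MeasurableSet.univ, Measure.restrict_univ]
    simp_rw [weight_eq_prod_two u1Rep β]
    rw [lintegral_prod_weight_eq_iterate hL hw hws, hN]
  -- `c · X_l ≤ Z` in both parities
  have hZge : c * (haarConv w)^[2 * (i + n) + 1] w 1 ≤ partitionFunction (d := 2) (L := L) u1Rep β := by
    rw [hZeq, ← hi]
    interval_cases b
    · rw [show N - 1 = 2 * l + 1 by omega]
      exact (mul_le_mul' hc1 le_rfl).trans (one_mul _).le
    · rw [show N - 1 = 2 * l + 2 by omega]
      exact mul_iterate_le_iterate_succ hβ (2 * l)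
  have hZ0 : partitionFunction (d := 2) (L := L) u1Rep β ≠ 0 := by
    rw [hZeq]; exact iterate_apply_ne_zero hw hw0 _ _
  have hZt : partitionFunction (d := 2) (L := L) u1Rep β ≠ ⊤ := by
    rw [hZeq]; exact ne_top_of_le_ne_top ENNReal.one_ne_top (iterate_apply_le_one hw hw1 _ _)
  -- the Wilson integral as `Z⁻¹ · ∫ f(U_·) ∏ w(U_x) dHaar^E`
  have hfhol : Measurable fun U : GaugeConfig 2 L Circle => f (fun x => plaquetteHolonomy U x 0 1) :=
    hfm.comp (measurable_pi_lambda _ fun x => measurable_plaquetteHolonomy x)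
  have hdens : Measurable fun U : GaugeConfig 2 L Circle =>
      ENNReal.ofReal (Real.exp (-β * wilsonAction u1Rep U)) := by
    have h : (fun U : GaugeConfig 2 L Circle => ENNReal.ofReal (Real.exp (-β * wilsonAction u1Rep U))) =
        fun U => ∏ x, w (plaquetteHolonomy U x 0 1) := funext (weight_eq_prod_two u1Rep β)
    rw [h]
    exact Finset.measurable_prod _ fun x _ => hw.comp (measurable_plaquetteHolonomy x)
  have hint : ∫⁻ U, f (fun x => plaquetteHolonomy U x 0 1) ∂(wilsonMeasure (d := 2) (L := L) u1Rep β) =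
      (partitionFunction (d := 2) (L := L) u1Rep β)⁻¹ *
        ∫⁻ U, f (fun x => plaquetteHolonomy U x 0 1) * ∏ x, w (plaquetteHolonomy U x 0 1)
          ∂(Measure.pi fun _ : Edge 2 L => haarProbability Circle) := by
    unfold wilsonMeasure
    rw [lintegral_smul_measure]
    congr 1
    unfold wilsonWeight
    rw [lintegral_withDensity_eq_lintegral_mul _ hdens hfhol]
    refine lintegral_congr fun U => ?_
    rw [Pi.mul_apply, weight_eq_prod_two u1Rep β U, mul_comm]
  have hNle := lintegral_weight_mul_le hL hw hws x₀ P hx₀ hfm hf hM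
  have hz1 : ∫⁻ g, w g ∂(haarProbability Circle) ≤ 1 := z1_le_one u1Rep U1.re_trace_u1Rep_le hβ
  -- assemble
  rw [hint]
  have hkn : n + P.card + k = 3 * n + b := by omega
  calc c * z1 u1Rep β ^ (n + P.card) * ((partitionFunction (d := 2) (L := L) u1Rep β)⁻¹ *
        ∫⁻ U, f (fun x => plaquetteHolonomy U x 0 1) * ∏ x, w (plaquetteHolonomy U x 0 1)
          ∂(Measure.pi fun _ : Edge 2 L => haarProbability Circle))
      ≤ c * z1 u1Rep β ^ (n + P.card) * ((partitionFunction (d := 2) (L := L) u1Rep β)⁻¹ *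
        ((haarConv w)^[2 * i + 1] w 1 * (∫⁻ g, w g ∂(haarProbability Circle)) ^ k *
          ∫⁻ g, f g * ∏ x ∈ P, w (g x) ∂(Measure.pi fun _ : Site 2 L => haarProbability Circle))) := by
        gcongr
    _ = (partitionFunction (d := 2) (L := L) u1Rep β)⁻¹ *
        (c * ((∫⁻ g, w g ∂(haarProbability Circle)) ^ (n + P.card) *
          (∫⁻ g, w g ∂(haarProbability Circle)) ^ k * (haarConv w)^[2 * i + 1] w 1)) *
          ∫⁻ g, f g * ∏ x ∈ P, w (g x) ∂(Measure.pi fun _ : Site 2 L => haarProbability Circle) := by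
        unfold z1; ring
    _ = (partitionFunction (d := 2) (L := L) u1Rep β)⁻¹ *
        (c * ((∫⁻ g, w g ∂(haarProbability Circle)) ^ b *
          ((∫⁻ g, w g ∂(haarProbability Circle)) ^ (3 * n) * (haarConv w)^[2 * i + 1] w 1))) *
          ∫⁻ g, f g * ∏ x ∈ P, w (g x) ∂(Measure.pi fun _ : Site 2 L => haarProbability Circle) := by
        rw [← pow_add, hkn, pow_add]; ring
    _ ≤ (partitionFunction (d := 2) (L := L) u1Rep β)⁻¹ * (c * (haarConv w)^[2 * (i + n) + 1] w 1) *
          ∫⁻ g, f g * ∏ x ∈ P, w (g x) ∂(Measure.pi fun _ : Site 2 L => haarProbability Circle) := by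
        have hstep : (∫⁻ g, w g ∂(haarProbability Circle)) ^ b *
            ((∫⁻ g, w g ∂(haarProbability Circle)) ^ (3 * n) * (haarConv w)^[2 * i + 1] w 1) ≤
            (haarConv w)^[2 * (i + n) + 1] w 1 :=
          calc _ ≤ 1 * (haarConv w)^[2 * (i + n) + 1] w 1 := mul_le_mul' (pow_le_one₀ zero_le hz1) hchain
            _ = _ := one_mul _
        exact mul_le_mul' (mul_le_mul' le_rfl (mul_le_mul' le_rfl hstep)) le_rfl
    _ ≤ (partitionFunction (d := 2) (L := L) u1Rep β)⁻¹ * partitionFunction (d := 2) (L := L) u1Rep β *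
          ∫⁻ g, f g * ∏ x ∈ P, w (g x) ∂(Measure.pi fun _ : Site 2 L => haarProbability Circle) :=
        mul_le_mul' (mul_le_mul' le_rfl hZge) le_rfl
    _ = ∫⁻ g, f g * ∏ x ∈ P, w (g x) ∂(Measure.pi fun _ : Site 2 L => haarProbability Circle) := by
        rw [ENNReal.inv_mul_cancel hZ0 hZt, one_mul]

/-! ## §3. Tails and the single-link law at every volume -/
/-- **PATCH-ACTION TAIL AT EVERY VOLUME**: `c(β)·z₁(β)^{n+#P}·μ_{β,L}{S_P ≥ a} ≤ e^{−βa}` (`L ≥ 2`, `β ≥ 0`, `#P ≤ 2n`,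
`2n + 2 ≤ L²`). [folklore] -/
theorem u1_mul_pow_mul_measure_actionSum_ge_le [NeZero L] (hL : 2 ≤ L) {β : ℝ} (hβ : 0 ≤ β)
    (P : Finset (Site 2 L)) (n : ℕ) (hPn : P.card ≤ 2 * n) (hn : 2 * n + 2 ≤ L ^ 2) (a : ℝ) :
    ENNReal.ofReal (Real.exp (-(3 / 2)) * (1 / Real.pi * (max 1 β)⁻¹)) * z1 u1Rep β ^ (n + P.card) *
        wilsonMeasure (d := 2) (L := L) u1Rep β
          {U | a ≤ ∑ x ∈ P, (1 - ((plaquetteHolonomy U x 0 1 : Circle) : ℂ).re)} ≤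
      ENNReal.ofReal (Real.exp (-(β * a))) := by
  classical
  set E : Set (Site 2 L → Circle) := {g | a ≤ ∑ x ∈ P, (1 - ((g x : Circle) : ℂ).re)} with hE
  have hcont : Continuous fun g : Site 2 L → Circle => ∑ x ∈ P, (1 - ((g x : Circle) : ℂ).re) := by
    fun_prop
  have hEm : MeasurableSet E := measurableSet_le measurable_const hcont.measurable
  have hS : MeasurableSet {U : GaugeConfig 2 L Circle |
      a ≤ ∑ x ∈ P, (1 - ((plaquetteHolonomy U x 0 1 : Circle) : ℂ).re)} :=
    hEm.preimage (measurable_pi_lambda _ fun x => measurable_plaquetteHolonomy x)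
  rw [← lintegral_indicator_one hS]
  have hind : ∀ U : GaugeConfig 2 L Circle,
      {U : GaugeConfig 2 L Circle | a ≤ ∑ x ∈ P, (1 - ((plaquetteHolonomy U x 0 1 : Circle) : ℂ).re)}.indicator
        (1 : GaugeConfig 2 L Circle → ℝ≥0∞) U = E.indicator 1 (fun x => plaquetteHolonomy U x 0 1) := by
    intro U; simp only [Set.indicator_apply, Set.mem_setOf_eq, hE, Pi.one_apply]
  simp_rw [hind]
  have hdep : ∀ g g' : Site 2 L → Circle, (∀ x ∈ P, g x = g' x) →
      E.indicator (1 : (Site 2 L → Circle) → ℝ≥0∞) g = E.indicator 1 g' := by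
    intro g g' hgg'
    have hsum : ∑ x ∈ P, (1 - ((g x : Circle) : ℂ).re) = ∑ x ∈ P, (1 - ((g' x : Circle) : ℂ).re) :=
      Finset.sum_congr rfl fun x hx => by rw [hgg' x hx]
    have hmem : g ∈ E ↔ g' ∈ E := by simp only [hE, Set.mem_setOf_eq, hsum]
    by_cases hg : g ∈ E
    · rw [Set.indicator_of_mem hg, Set.indicator_of_mem (hmem.mp hg)]; rfl
    · rw [Set.indicator_of_notMem hg, Set.indicator_of_notMem (fun h => hg (hmem.mpr h))]
  refine (u1_mul_pow_mul_lintegral_le hL hβ P n hPn hn (measurable_one.indicator hEm) hdep).trans ?_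
  calc ∫⁻ g, E.indicator 1 g * ∏ x ∈ P,
          ENNReal.ofReal (Real.exp (-(β * (((1 : ℕ) : ℝ) - (u1Rep (g x)).trace.re))))
          ∂(Measure.pi fun _ : Site 2 L => haarProbability Circle)
      ≤ ∫⁻ _, ENNReal.ofReal (Real.exp (-(β * a))) ∂(Measure.pi fun _ : Site 2 L => haarProbability Circle) := by
        refine lintegral_mono fun g => ?_
        by_cases hg : g ∈ E
        · rw [Set.indicator_of_mem hg, Pi.one_apply, one_mul,
            ← ENNReal.ofReal_prod_of_nonneg (fun _ _ => (Real.exp_pos _).le), ← Real.exp_sum]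
          refine ENNReal.ofReal_le_ofReal (Real.exp_le_exp.mpr ?_)
          simp only [trace_u1Rep_re, Nat.cast_one]
          rw [Finset.sum_neg_distrib, ← Finset.mul_sum]
          have ha : a ≤ ∑ x ∈ P, (1 - ((g x : Circle) : ℂ).re) := hg
          exact neg_le_neg (mul_le_mul_of_nonneg_left ha hβ)
        · rw [Set.indicator_of_notMem hg, zero_mul]; exact bot_le
    _ = ENNReal.ofReal (Real.exp (-(β * a))) := by rw [lintegral_const, measure_univ, mul_one]

/-- **THE SINGLE-LINK TUNNELLING LAW AT EVERY VOLUME** (`L ≥ 2`, `β ≥ 0`, odd `L` included):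
`c(β)·z₁(β)³·(μ_{β,L} ⊗ κ){Q ≠ Q'} ≤ 2·e^{−2β}` for every `μ_{β,L}`-invariant Markov kernel changing one link,
`c(β) = e^{−3/2}/(π·max(1,β))`. [folklore] -/
theorem u1_tunnelling_single_link_all [NeZero L] (hL : 2 ≤ L) {β : ℝ} (hβ : 0 ≤ β)
    (x₀ : Site 2 L) (e₀ : Edge 2 L)
    (κ : Kernel (GaugeConfig 2 L Circle) (GaugeConfig 2 L Circle)) [IsMarkovKernel κ]
    (hinv : κ.Invariant (wilsonMeasure (d := 2) (L := L) u1Rep β))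
    (hloc : ∀ᵐ q ∂((wilsonMeasure (d := 2) (L := L) u1Rep β) ⊗ₘ κ), ∀ e, e ≠ e₀ → q.1 e = q.2 e) :
    ENNReal.ofReal (Real.exp (-(3 / 2)) * (1 / Real.pi * (max 1 β)⁻¹)) * z1 u1Rep β ^ 3 *
        ((wilsonMeasure (d := 2) (L := L) u1Rep β) ⊗ₘ κ)
          {q | Flux.topCharge x₀ 0 1 q.1 ≠ Flux.topCharge x₀ 0 1 q.2} ≤
      2 * ENNReal.ofReal (Real.exp (-(2 * β))) := by
  classical
  set μW := wilsonMeasure (d := 2) (L := L) u1Rep β with hμW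
  haveI : IsProbabilityMeasure μW := isProbabilityMeasure_wilsonMeasure u1Rep continuous_u1Rep β
  set c : ℝ≥0∞ := ENNReal.ofReal (Real.exp (-(3 / 2)) * (1 / Real.pi * (max 1 β)⁻¹)) with hc
  set P' : Finset (ZMod L × ZMod L) :=
    Finset.univ.filter fun p => e₀ ∈ plaqLinks (planeSite x₀ 0 1 p) 0 1 with hP'
  have hP : ∀ p, (∃ e ∈ plaqLinks (planeSite x₀ 0 1 p) 0 1, e ∈ ({e₀} : Finset (Edge 2 L))) → p ∈ P' := by
    rintro p ⟨e, he, he0⟩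
    rw [Finset.mem_singleton] at he0
    subst he0
    exact Finset.mem_filter.mpr ⟨Finset.mem_univ _, he⟩
  have hPne : P'.Nonempty := by
    refine ⟨((e₀.1 - x₀) 0, (e₀.1 - x₀) 1), Finset.mem_filter.mpr ⟨Finset.mem_univ _, ?_⟩⟩
    rw [(planeSite_eq_iff x₀ e₀.1 _).mpr rfl]
    obtain ⟨y, i⟩ := e₀
    fin_cases i <;> simp [plaqLinks]
  have hcard : P'.card ≤ 2 := card_touched_le_two x₀ e₀
  have hthr : (P'.card : ℝ) * (1 - Real.cos (Real.pi / P'.card)) = 2 := by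
    have h1 : 1 ≤ P'.card := hPne.card_pos
    interval_cases h : P'.card
    · simp [Real.cos_pi]; norm_num
    · simp [Real.cos_pi_div_two]
  have hloc' : ∀ᵐ q ∂(μW ⊗ₘ κ), ∀ e ∉ ({e₀} : Finset (Edge 2 L)), q.1 e = q.2 e := by
    filter_upwards [hloc] with q hq e he
    exact hq e (fun h => he (Finset.mem_singleton.mpr h))
  have hlaw := compProd_topCharge_ne_le_of_links_sharp x₀ 0 1 {e₀} hPne hP μW κ hinv hloc'
  set P : Finset (Site 2 L) := P'.image (planeSite x₀ 0 1) with hPdef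
  have hinj : Set.InjOn (planeSite x₀ 0 1) (P' : Set (ZMod L × ZMod L)) := by
    intro p _ q _ hpq
    rw [(planeSite_eq_iff x₀ _ p).mp hpq, ← (planeSite_eq_iff x₀ _ q).mp rfl]
  have hPcard : P.card ≤ 2 * 1 := by rw [hPdef, Finset.card_image_of_injOn hinj]; omega
  have hset : {U : GaugeConfig 2 L Circle | (P'.card : ℝ) * (1 - Real.cos (Real.pi / P'.card)) ≤
      patchAction x₀ 0 1 P' U} =
      {U | (2 : ℝ) ≤ ∑ x ∈ P, (1 - ((plaquetteHolonomy U x 0 1 : Circle) : ℂ).re)} := by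
    ext U
    simp only [Set.mem_setOf_eq, hthr, patchAction, hPdef, Finset.sum_image hinj]
  have hn : 2 * 1 + 2 ≤ L ^ 2 := by nlinarith
  have htail := u1_mul_pow_mul_measure_actionSum_ge_le hL hβ P 1 hPcard hn 2
  have hz1 : z1 u1Rep β ≤ 1 := z1_le_one u1Rep U1.re_trace_u1Rep_le hβ
  rw [hset] at hlaw
  calc c * z1 u1Rep β ^ 3 * (μW ⊗ₘ κ) {q | Flux.topCharge x₀ 0 1 q.1 ≠ Flux.topCharge x₀ 0 1 q.2}
      ≤ c * z1 u1Rep β ^ (1 + P.card) *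
          (2 * μW {U | (2 : ℝ) ≤ ∑ x ∈ P, (1 - ((plaquetteHolonomy U x 0 1 : Circle) : ℂ).re)}) :=
        mul_le_mul' (mul_le_mul' le_rfl (pow_le_pow_right_of_le_one' hz1 (by omega))) hlaw
    _ = 2 * (c * z1 u1Rep β ^ (1 + P.card) *
          μW {U | (2 : ℝ) ≤ ∑ x ∈ P, (1 - ((plaquetteHolonomy U x 0 1 : Circle) : ℂ).re)}) := by ring
    _ ≤ 2 * ENNReal.ofReal (Real.exp (-(β * 2))) := mul_le_mul' le_rfl htail
    _ = 2 * ENNReal.ofReal (Real.exp (-(2 * β))) := by rw [mul_comm β 2]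

/-- **IN NUMBERS, EVERY VOLUME** (`β ≥ 1`, `L ≥ 2`): `(μ_{β,L} ⊗ κ){Q ≠ Q'} ≤ 2·e³π⁴·β^{5/2}·e^{−2β}` for every exact
single-link sampler of 2-d `U(1)` (`c(β)·z₁(β)³ ≥ e^{−3}/(π⁴β^{5/2})`). [folklore] -/
theorem u1_tunnelling_single_link_all_explicit [NeZero L] (hL : 2 ≤ L) {β : ℝ} (hβ : 1 ≤ β)
    (x₀ : Site 2 L) (e₀ : Edge 2 L)
    (κ : Kernel (GaugeConfig 2 L Circle) (GaugeConfig 2 L Circle)) [IsMarkovKernel κ]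
    (hinv : κ.Invariant (wilsonMeasure (d := 2) (L := L) u1Rep β))
    (hloc : ∀ᵐ q ∂((wilsonMeasure (d := 2) (L := L) u1Rep β) ⊗ₘ κ), ∀ e, e ≠ e₀ → q.1 e = q.2 e) :
    ((wilsonMeasure (d := 2) (L := L) u1Rep β) ⊗ₘ κ) {q | Flux.topCharge x₀ 0 1 q.1 ≠ Flux.topCharge x₀ 0 1 q.2} ≤
      ENNReal.ofReal (2 * (Real.exp 3 * Real.pi ^ 4 * Real.sqrt β ^ 5) * Real.exp (-(2 * β))) := by
  have hβ0 : 0 ≤ β := by linarith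
  have h := u1_tunnelling_single_link_all hL hβ0 x₀ e₀ κ hinv hloc
  have hsq2 : Real.sqrt β ^ 2 = β := Real.sq_sqrt hβ0
  rw [max_eq_right hβ] at h
  set r : ℝ := Real.exp (-(3 / 2)) * (1 / Real.pi * β⁻¹) * (Real.exp (-(1 / 2)) * (1 / Real.pi * (Real.sqrt β)⁻¹)) ^ 3
    with hr
  have hr0 : 0 < r := by positivity
  have hrle : ENNReal.ofReal r ≤ ENNReal.ofReal (Real.exp (-(3 / 2)) * (1 / Real.pi * β⁻¹)) * z1 u1Rep β ^ 3 := by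
    rw [hr, ENNReal.ofReal_mul (by positivity), ENNReal.ofReal_pow (by positivity)]
    exact mul_le_mul' le_rfl (pow_le_pow_left' (inv_sqrt_le_z1 hβ) 3)
  set X := ((wilsonMeasure (d := 2) (L := L) u1Rep β) ⊗ₘ κ) {q | Flux.topCharge x₀ 0 1 q.1 ≠ Flux.topCharge x₀ 0 1 q.2}
  have hrX : ENNReal.ofReal r * X ≤ ENNReal.ofReal (2 * Real.exp (-(2 * β))) :=
    calc ENNReal.ofReal r * X ≤ _ := mul_le_mul' hrle le_rfl
      _ ≤ 2 * ENNReal.ofReal (Real.exp (-(2 * β))) := h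
      _ = _ := by rw [ENNReal.ofReal_mul (by norm_num : (0:ℝ) ≤ 2), ENNReal.ofReal_ofNat]
  have hr3 : ENNReal.ofReal r ≠ 0 := (ENNReal.ofReal_pos.mpr hr0).ne'
  calc X ≤ ENNReal.ofReal (2 * Real.exp (-(2 * β))) / ENNReal.ofReal r :=
        (ENNReal.le_div_iff_mul_le (Or.inl hr3) (Or.inl ENNReal.ofReal_ne_top)).mpr (by rw [mul_comm]; exact hrX)
    _ = ENNReal.ofReal (2 * Real.exp (-(2 * β)) / r) := (ENNReal.ofReal_div_of_pos hr0).symm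
    _ = _ := by
        congr 1
        have hE3 : Real.exp (-(3 / 2)) = Real.exp (-(1 / 2)) ^ 3 := by rw [← Real.exp_nat_mul]; norm_num
        have hE6 : Real.exp 3 = (Real.exp (-(1 / 2)) ^ 6)⁻¹ := by rw [← Real.exp_nat_mul, ← Real.exp_neg]; norm_num
        have hE0 : Real.exp (-(1 / 2)) ≠ 0 := (Real.exp_pos _).ne'
        rw [hr, hE3, hE6, show Real.sqrt β ^ 5 = Real.sqrt β ^ 2 * Real.sqrt β ^ 3 from pow_add _ 2 3, hsq2]
        field_simp

end Summit.Ventures.LatticeQCDFlow.Theory2.Lattice.TwoDim
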